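import Literature.IUT.LogVolume.DegreeVolumeConversion
import Literature.IUT.LogVolume.LocalFieldVolume
import Literature.NumberTheory.GaloisRepresentations.AdicCompletionUniformizer
import HarnessLib

/-!
# A model of the packet interface from the completions `F_v` (Dupuy–Hilado Thm. 3.10.1 (i), the
# case `r = 1`): the axioms (3.4)/(3.7) DISCHARGED against Haar measure on Mathlib's `v.adicCompletion F`

Dupuy–Hilado, arXiv:2004.13228 (pre-split text; Ramanujan J. **68** (2025)), read on the page (corpus
render `paper:arxiv-2004.13228`, chunks 7–8, 12): (2.5.5) "`ln μ_{L_v}(t_v O_v) = ln‖t_v‖_v =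
−deĝ(ord_v(t_v)[v])`"; (3.4) "`log μ̄_{F_{0,v}}(a_v O_v) = ln|a_v|_p = −deĝ(ord_v(a_v)[v])/[F_{0,v}:ℚ_p]`";
Thm. 3.10.1 (i) "(Conversion for Adeles) If `D ∈ Div̂(F₀)` then for every `r ≥ 1` we have `−deĝ̲_{F₀}(D) =
log μ̄_{𝔸_{F₀}}(O_{𝔸_{F₀}}(−D)) = …`", with the proof "`log μ̄_{𝔸_{F₀,p}}(O_{𝔸_{F₀,p}}(−D)) =
𝔼(log μ̄_{F_{0,v}}(t_v O_v) : v ∈ V(F₀)_p) = 𝔼(−deĝ(ord_v(t_v)[v])/[F_{0,v}:ℚ_p]) = … = −deĝ̲(D)`".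

`DegreeVolumeConversion` proves Thm. 3.10.1 over the INTERFACE `PacketModel`, whose one measure-theoretic
axiom is (3.7) with (3.4). This file CONSTRUCTS a `PacketModel F` in which that axiom is a THEOREM of Haar
measure: the summand indexed by `v⃗ = (v_0,…,v_j)` is the completion `F_{v_j}` of `F` at the LAST place
(Mathlib's `v.adicCompletion F`, a proper nonarchimedean local field by the tree's
`Literature.NumberTheory.Automorphic.properSpace_adicCompletion`), admissible sets are those of positive
finite Haar measure, `log μ̄ := μ^log_{F_v}/n_v` with `μ^log_{F_v}` the normalised log-volume of
`Literature.IUT.LogVolume.LocalFieldVolume` ([AbsTopIII] Prop. 5.7 (i): `μ(O_v) = 1`,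
`μ^log(x·A) = μ^log(A) + μ̇^log(x)`), the integral structure is `O_v = closedBall 0 1`, the local scalars
are `F_vˣ` with `ord_v` read off `Valued.v`, and the peel action is multiplication. The key computation,
`mulLogVolume_eq` : `μ̇^log_{F_v}(y) = log‖y‖ = −ord_v(y)·ln|κ(v)|` (via the tree's
`distribHaarChar_eq_inv_absNorm` for a uniformizer and `distribHaarChar_eq_one_of_norm_eq_one` for units),
IS (2.5.5)/(3.4) as a theorem. Consequently (`lnνL_region_completionModel`) Thm. 3.10.1 holds
UNCONDITIONALLY in this model: for every lgp-idele `t` of `F`, `ln ν̄_𝕃(O_𝕃(−div t)) = −deĝ̲_lgp(div t)`.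

WHAT THIS MODEL IS AND IS NOT. It is Dupuy–Hilado's `𝔸_{F₀}` (the case `r = 1` of Thm. 3.10.1 (i), first
equality) placed in every tensor degree: the summand `K_{v̲_0} ⊗_{ℚ_p} ⋯ ⊗ K_{v̲_j}` of DH's `𝔸^{⊗ j+1}` is
REPLACED by its last factor `F_{v_j}` (with `K = F₀ = F`). So it discharges the interface axioms at the
level of single completions and shows the interface consistent with real Haar measure; it is NOT the
tensor-packet model (tensor products of local fields with their integral structures — [IUTchIV]
Prop. 1.1–1.4, the campaign's S1/S2 files — remain to be assembled into a `PacketModel`), and it carries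
no (Ind1) transport (the last factors at `v⃗` and `v⃗∘σ` are different fields). [cite: DupuyHilado2025,
§2.5.5, §3.4, Thm. 3.10.1] Deliberately NOT here: anything about [IUTchIII] Cor. 3.12.
-/

noncomputable section

namespace Literature.IUT.LogVolume

open NumberField IsDedekindDomain MeasureTheory Metric Set
open Literature.NumberTheory.GaloisRepresentations.Ultrametric
open scoped NNReal ENNReal Pointwise

variable (F : Type) [Field F] [NumberField F]

namespace CompletionModel

variable (v : HeightOneSpectrum (𝓞 F))

attribute [local instance] AdicCompletion.nontriviallyNormedField
attribute [local instance] Literature.NumberTheory.Automorphic.properSpace_adicCompletion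

/-- The Borel σ-algebra on `F_v` (local instance). [folklore] -/
@[reducible] def measurableSpace : MeasurableSpace (v.adicCompletion F) := borel _

attribute [local instance] measurableSpace

/-- `F_v` with its Borel σ-algebra is a Borel space (local instance; plumbing). [folklore] -/
private theorem borelSpace : BorelSpace (v.adicCompletion F) := ⟨rfl⟩

attribute [local instance] borelSpace

/-- `ord_v : F_vˣ → ℤ`, read off Mathlib's `Valued.v` (a uniformizer has `Valued.v = exp(−1)`, `ord_v = 1`).
[cite: DupuyHilado2025, §2.4.2] -/
def ordv (y : (v.adicCompletion F)ˣ) : ℤ :=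
  -(WithZero.unzero ((Valuation.ne_zero_iff Valued.v).mpr y.ne_zero)).toAdd

/-- `‖y‖ = |κ(v)|^{−ord_v(y)}` on `F_vˣ` (Mathlib's normalisation of the `v`-adic norm).
[cite: DupuyHilado2025, §2.4.6] -/
theorem norm_units (y : (v.adicCompletion F)ˣ) :
    ‖(y : v.adicCompletion F)‖ = ((Ideal.absNorm v.asIdeal : ℕ) : ℝ) ^ (-ordv F v y) := by
  rw [ordv, neg_neg]
  exact AdicCompletion.norm_units_eq_absNorm_zpow F v y

/-- **The modulus is the normalised absolute value**: `mod_{F_v}(y) = ‖y‖` for every `y ∈ F_vˣ` (uniformizer: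
tree `distribHaarChar_eq_inv_absNorm`; units of norm one: `distribHaarChar_eq_one_of_norm_eq_one`).
[cite: DupuyHilado2025, §2.4.6] -/
theorem distribHaarChar_eq_norm (y : (v.adicCompletion F)ˣ) :
    ((distribHaarChar (v.adicCompletion F) y : ℝ≥0) : ℝ) = ‖(y : v.adicCompletion F)‖ := by
  obtain ⟨ϖ, hϖ⟩ := Literature.NumberTheory.Automorphic.exists_valuation_eq_exp_neg_one F v
  have hu := AdicCompletion.isUniformizer_of_valuation_eq F v ϖ (by rw [hϖ]; rfl)
  have hΔϖ : ((distribHaarChar (v.adicCompletion F) ϖ : ℝ≥0) : ℝ) = ‖(ϖ : v.adicCompletion F)‖ := by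
    rw [AdicCompletion.distribHaarChar_eq_inv_absNorm F v ϖ hu.1, hu.2, NNReal.coe_inv, NNReal.coe_natCast]
  have hN : (((Ideal.absNorm v.asIdeal : ℕ) : ℝ)) ≠ 0 := by
    have := NumberField.HeightOneSpectrum.one_lt_absNorm v
    positivity
  have hϖ0 : ‖(ϖ : v.adicCompletion F)‖ ≠ 0 := by rw [hu.2]; exact inv_ne_zero hN
  -- `u := y · ϖ^{−ord y}` has norm one
  set n := ordv F v y with hn
  have hunit : ‖((y * ϖ ^ (-n) : (v.adicCompletion F)ˣ) : v.adicCompletion F)‖ = 1 := by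
    rw [Units.val_mul, Units.val_zpow_eq_zpow_val, norm_mul, norm_zpow, norm_units, hu.2, inv_zpow',
      neg_neg, ← zpow_add₀ hN, ← hn, neg_add_cancel, zpow_zero]
  have hΔu := distribHaarChar_eq_one_of_norm_eq_one (y * ϖ ^ (-n)) hunit
  have hy : y = (y * ϖ ^ (-n)) * ϖ ^ n := by rw [mul_assoc, ← zpow_add, neg_add_cancel, zpow_zero, mul_one]
  rw [hy, map_mul, map_zpow, hΔu, one_mul, NNReal.coe_zpow, hΔϖ, Units.val_mul, Units.val_zpow_eq_zpow_val,
    norm_mul, hunit, one_mul, norm_zpow]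

/-- **(2.5.5)/(3.4) as a theorem**: `μ̇^log_{F_v}(y) = log μ_v(y·O_v) = −ord_v(y)·ln|κ(v)|`.
[cite: DupuyHilado2025, §2.5.5, §3.4] -/
theorem mulLogVolume_eq (y : (v.adicCompletion F)ˣ) :
    mulLogVolume (v.adicCompletion F) y = -(ordv F v y) * logNorm F v := by
  rw [mulLogVolume_eq_log_distribHaarChar, distribHaarChar_eq_norm, norm_units, Real.log_zpow, logNorm]
  push_cast
  ring

/-- Admissible subsets of `F_v`: positive finite Haar measure. [cite: DupuyHilado2025, Def. 3.5.1] -/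
def Adm (A : Set (v.adicCompletion F)) : Prop :=
  0 < localVolume (v.adicCompletion F) A ∧ localVolume (v.adicCompletion F) A < ∞

/-- The normalised log-measure `log μ̄_v := μ^log_{F_v}/n_v` (§3.4 "`log μ̄_W := log μ_W/dim_{ℚ_p} W`", with
`n_v = e_v f_v` for `[F_v:ℚ_p]`, cf. `FakeAdeleIndex`). [cite: DupuyHilado2025, §3.4] -/
def logμ (A : Set (v.adicCompletion F)) : ℝ := localLogVolume (v.adicCompletion F) A / localDegree F v

/-- `log μ̄_v` is monotone on admissible sets. [cite: DupuyHilado2025, §3.4] -/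
theorem logμ_mono {A B : Set (v.adicCompletion F)} (hA : Adm F v A) (hB : Adm F v B) (h : A ⊆ B) :
    logμ F v A ≤ logμ F v B :=
  div_le_div_of_nonneg_right ((unitBallStructure (v.adicCompletion F)).logVolume_mono hA.1 hB.2 h)
    (by exact_mod_cast (localDegree_pos F v).le)

/-- `O_v` is admissible (`μ(O_v) = 1`). [cite: DupuyHilado2025, §2.4.5] -/
theorem adm_closedBall : Adm F v (closedBall (0 : v.adicCompletion F) 1) := by
  refine ⟨?_, ?_⟩ <;> simp [localVolume_closedBall_one]

/-- `log μ̄_v(O_v) = 0`. [cite: DupuyHilado2025, §2.4.5] -/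
theorem logμ_closedBall : logμ F v (closedBall (0 : v.adicCompletion F) 1) = 0 := by
  simp [logμ]

/-- Multiplication by `y ∈ F_vˣ` preserves admissibility (`μ(y·A) = mod(y)·μ(A)`).
[cite: DupuyHilado2025, §2.4.6] -/
theorem adm_smul (y : (v.adicCompletion F)ˣ) {A : Set (v.adicCompletion F)} (hA : Adm F v A) :
    Adm F v (y • A) := by
  have hΔ : (0 : ℝ≥0∞) < distribHaarChar (v.adicCompletion F) y := by
    exact_mod_cast distribHaarChar_pos
  refine ⟨?_, ?_⟩
  · rw [localVolume_units_smul]; exact ENNReal.mul_pos hΔ.ne' hA.1.ne'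
  · rw [localVolume_units_smul]; exact ENNReal.mul_lt_top ENNReal.coe_lt_top hA.2

/-- **(3.7) with (3.4) as a theorem**: `log μ̄_v(y·A) = −ord_v(y)·ln|κ(v)|/n_v + log μ̄_v(A)`.
[cite: DupuyHilado2025, §3.4, §3.7] -/
theorem logμ_smul (y : (v.adicCompletion F)ˣ) {A : Set (v.adicCompletion F)} (hA : Adm F v A) :
    logμ F v (y • A) = -(ordv F v y : ℝ) * logNorm F v / localDegree F v + logμ F v A := by
  rw [logμ, localLogVolume_units_smul _ y hA.1 hA.2, mulLogVolume_eq, logμ, add_div, add_comm]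

end CompletionModel

open CompletionModel in
/-- **The completion model** of the packet interface: summand at `v⃗ = (v_0,…,v_j)` := `F_{v_j}`, admissible =
positive finite Haar measure, `log μ̄ = μ^log_{F_v}/n_v`, `O = closedBall 0 1`, scalars `F_vˣ` with `ord_v`,
peel = multiplication — every field a theorem of Haar measure on Mathlib's `adicCompletion` (module
docstring: this is DH's `𝔸_{F₀}`, Thm. 3.10.1 (i) `r = 1`, in each degree; not the tensor-packet model).
[cite: DupuyHilado2025, §3.4, §3.7, Thm. 3.10.1] -/
def completionModel : PacketModel F := by
  letI := fun (w : HeightOneSpectrum (𝓞 F)) => AdicCompletion.nontriviallyNormedField F w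
  exact
  { X := fun p j e => (e (Fin.last j)).1.adicCompletion F
    adm := fun {p j e} A => Adm F (e (Fin.last j)).1 A
    logμ := fun {p j e} A => logμ F (e (Fin.last j)).1 A
    logμ_mono := fun {p j e} A B hA hB h => logμ_mono F _ hA hB h
    O := fun p j e => closedBall (0 : (e (Fin.last j)).1.adicCompletion F) 1
    O_adm := fun p j e => adm_closedBall F _
    logμ_O := fun p j e => logμ_closedBall F _
    Λ := fun p w => (w.1.adicCompletion F)ˣ
    ordv := fun {p w} y => (ordv F w.1 y : ℝ)
    peel := fun {p j e} y x => (y : (e (Fin.last j)).1.adicCompletion F) * x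
    peel_adm := fun {p j e} y U hU => by
      have h : (fun x => (y : (e (Fin.last j)).1.adicCompletion F) * x) '' U = y • U := rfl
      rw [h]; exact adm_smul F _ y hU
    logμ_peel := fun {p j e} y U hU => by
      have h : (fun x => (y : (e (Fin.last j)).1.adicCompletion F) * x) '' U = y • U := rfl
      rw [h]; exact logμ_smul F _ y hU }

/-- **Thm. 3.10.1 in the completion model, unconditionally**: for every lgp-idele `t` of `F` and finite set of
primes `T`, `ln ν̄_𝕃(O_𝕃(−div_T t)) = −deĝ̲_lgp(div_T t)` — the interface theorem
`PacketModel.lnνL_region_eq_neg_ndegLgp` with its measure axiom now discharged.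
[cite: DupuyHilado2025, Thm. 3.10.1] -/
theorem lnνL_region_completionModel {lstar : ℕ} (t : (completionModel F).LgpIdele lstar) (T : Finset ℕ)
    (hT : ∀ p ∈ T, p.Prime) :
    (completionModel F).lnνL lstar T ((completionModel F).region t) =
      -LgpDivisor.ndegLgp (PacketModel.LgpIdele.div (completionModel F) t T) :=
  (completionModel F).lnνL_region_eq_neg_ndegLgp t T hT

/-- Every real divisor coefficient is realised in this model only through INTEGER valuations: the scalars
are `F_vˣ`, so `ord_v(t) ∈ ℤ` — Thm. 3.10.1 (i) is stated for `D ∈ Div̂(F₀)` (integral coefficients); the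
`ℤ[1/d]`-coefficients of (ii)/(iii) need the extension `K/F₀` of initial theta data. [cite: DupuyHilado2025, Thm. 3.10.1] -/
theorem ordv_int {p : ℕ} (w : placesOver F p) (y : (completionModel F).Λ p w) :
    ∃ n : ℤ, (completionModel F).ordv y = n :=
  ⟨CompletionModel.ordv F w.1 y, rfl⟩

end Literature.IUT.LogVolume

end
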